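import Mathlib
import HarnessLib
import Summits.AtomisticToContinuum.Crystallization.Theorems.PricedLinkCensusSoftLayerPropagationStubBallPropagationCaseA
import Summits.AtomisticToContinuum.Crystallization.Theorems.BrittleRungDescentSoftLayerPropagationCaseHSchedule
import Summits.AtomisticToContinuum.Crystallization.Theorems.BrittleRungDescentSoftLayerPropagationCaseHLayers

/-!
# Local layer propagation, HCP case: assembly

Route `BrittleRungDescent`, support item `SoftLayerPropagation` (stmt-AtomisticToContinuum-9210),
helper file (η = 0).  The proof follows `caseA` of `PricedLinkCensus…CaseA.lean` with the radii
schedules of `…CaseHSchedule.lean` (parametric in `R`) and the walk of `…CaseHLayers.lean`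
in place of the no-room comparison on a fixed ball.

* `caseH_ball` — **the HCP case of the finite-ball statement.**  Let `V` be a packing of unit
  balls, `u` a point, `R ≥ 4`, with FCC/HCP shells at every centre within `2R − 2` of `u`.
  Let `q` be a centre within `2R − 2` of `u` with a frame `L` in which the shell of `q` is the HCP
  layer shell `layerShell s₀ s₀` and the moved point `u′` is at height between `0` and `R − 3/2`
  above the base plane.  Then the centres within `R` of `u` lie in a moved Barlow stacking.
* `hcp_descent` — from the HCP centre at the origin to an HCP centre of the base lattice within
  `√2` of the foot `c` of `u′`, through equatorial neighbours ever closer to `c`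
  (`exists_mem_hexagonSet_norm_sq_lt` + `kissingShell_add_eq_layerShell_of_hcp_dir`).

All statements are elementary ([folklore]; the layer picture is [cite: HalesDSP2012, §1.3]).
-/

noncomputable section

namespace Summit.AtomisticToContinuum.Crystallization.Theorems

open Literature.Geometry.DiscreteGeometry Literature.MathematicalPhysics.StatisticalMechanics
open RealInnerProductSpace

/-- **Descent along the mirror plane.**  If the origin is a centre with HCP shell
`layerShell s s`, `c` is a point of the base plane, and every centre of the base lattice at most
as far from `c` as the origin has an FCC/HCP shell, then some point of the base lattice within
`√2` of `c` is a centre with shell `layerShell s s`. [folklore] -/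
theorem hcp_descent {V : Set (EuclideanSpace ℝ (Fin 3))} (hV : IsUnitBallPacking V) {s : ℝ}
    (hs : s = 1 ∨ s = -1) {c : EuclideanSpace ℝ (Fin 3)} (hc : c 2 = 0)
    (hpat : ∀ i j : ℤ,
      ‖((i : ℝ) • (triangularVec₁ 2 : EuclideanSpace ℝ (Fin 3)) + (j : ℝ) • triangularVec₂ 2) - c‖ ≤ ‖c‖ →
      (i : ℝ) • (triangularVec₁ 2 : EuclideanSpace ℝ (Fin 3)) + (j : ℝ) • triangularVec₂ 2 ∈ V →
      IsArrangedIn (kissingShell V ((i : ℝ) • (triangularVec₁ 2 : EuclideanSpace ℝ (Fin 3)) +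
          (j : ℝ) • triangularVec₂ 2)) fccKissingPattern ∨
        IsArrangedIn (kissingShell V ((i : ℝ) • (triangularVec₁ 2 : EuclideanSpace ℝ (Fin 3)) +
          (j : ℝ) • triangularVec₂ 2)) hcpKissingPattern)
    (h0V : (0 : EuclideanSpace ℝ (Fin 3)) ∈ V) (h0 : kissingShell V 0 = layerShell s s) :
    ∃ i₀ j₀ : ℤ,
      ‖((i₀ : ℝ) • (triangularVec₁ 2 : EuclideanSpace ℝ (Fin 3)) + (j₀ : ℝ) • triangularVec₂ 2) - c‖ ^ 2 ≤ 2 ∧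
      (i₀ : ℝ) • (triangularVec₁ 2 : EuclideanSpace ℝ (Fin 3)) + (j₀ : ℝ) • triangularVec₂ 2 ∈ V ∧
      kissingShell V ((i₀ : ℝ) • (triangularVec₁ 2 : EuclideanSpace ℝ (Fin 3)) + (j₀ : ℝ) • triangularVec₂ 2)
        = layerShell s s := by
  set Lat : ℤ → ℤ → EuclideanSpace ℝ (Fin 3) := fun i j =>
    (i : ℝ) • (triangularVec₁ 2 : EuclideanSpace ℝ (Fin 3)) + (j : ℝ) • triangularVec₂ 2 with hLat
  -- induction on `⌈‖p − c‖² / 0.8⌉` over HCP centres `p` of the lattice at most `‖c‖` from `c`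
  suffices H : ∀ n : ℕ, ∀ i j : ℤ, Lat i j ∈ V → kissingShell V (Lat i j) = layerShell s s →
      ‖Lat i j - c‖ ≤ ‖c‖ → ‖Lat i j - c‖ ^ 2 ≤ 0.8 * n →
      ∃ i₀ j₀ : ℤ, ‖Lat i₀ j₀ - c‖ ^ 2 ≤ 2 ∧ Lat i₀ j₀ ∈ V ∧
        kissingShell V (Lat i₀ j₀) = layerShell s s by
    have h00 : Lat 0 0 = 0 := by simp [hLat]
    exact H ⌈‖c‖ ^ 2 / 0.8⌉₊ 0 0 (by rw [h00]; exact h0V) (by rw [h00]; exact h0) (by simp [h00])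
      (by rw [h00, zero_sub, norm_neg]
          have := Nat.le_ceil (‖c‖ ^ 2 / 0.8)
          rw [div_le_iff₀ (by norm_num)] at this
          linarith)
  intro n
  induction n with
  | zero =>
    intro i j hV0 hsh _ hn
    exact ⟨i, j, by push_cast at hn; linarith, hV0, hsh⟩
  | succ n ih =>
    intro i j hijV hsh hle hn
    by_cases hsmall : ‖Lat i j - c‖ ^ 2 ≤ 2
    · exact ⟨i, j, hsmall, hijV, hsh⟩
    · -- a hexagon step towards `c`
      have hp2 : (Lat i j) 2 = 0 := lattice_apply_two i j
      obtain ⟨η, hη, hlt⟩ := exists_mem_hexagonSet_norm_sq_lt hp2 hc (t := 1.2) (by norm_num)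
        (by have := not_le.mp hsmall; nlinarith)
      obtain ⟨a, b, hab⟩ := exists_int_of_mem_hexagonSet hη
      have e : Lat i j + η = Lat (i + a) (j + b) := by
        rw [hab]; simp only [hLat]; push_cast; module
      have hle' : ‖Lat (i + a) (j + b) - c‖ ≤ ‖c‖ := by
        have h1 : ‖Lat (i + a) (j + b) - c‖ ^ 2 ≤ ‖Lat i j - c‖ ^ 2 := by rw [← e]; linarith
        have h2 := abs_le_of_sq_le_sq' h1 (norm_nonneg _)
        exact h2.2.trans hle
      have hηV : Lat i j + η ∈ V := by
        have : η ∈ kissingShell V (Lat i j) := by rw [hsh]; exact hexagonSet_subset_layerShell _ _ hη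
        exact this.1
      have hpat' : IsArrangedIn (kissingShell V (Lat i j + η)) fccKissingPattern ∨
          IsArrangedIn (kissingShell V (Lat i j + η)) hcpKissingPattern := by
        have hmem : Lat (i + a) (j + b) ∈ V := by rw [← e]; exact hηV
        have := hpat (i + a) (j + b) (by simpa [hLat] using hle') (by simpa [hLat] using hmem)
        rw [e]; simpa [hLat] using this
      obtain ⟨-, hsh'⟩ := kissingShell_add_eq_layerShell_of_hcp_dir hV hs hijV hsh hη hpat'
      rw [e] at hsh'
      exact ih (i + a) (j + b) (by rw [← e]; exact hηV) hsh' hle'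
        (by rw [← e]; push_cast at hn ⊢; linarith)

/-- **The HCP case of the finite-ball statement** (see the module docstring).
[cite: HalesDSP2012, §1.3] -/
theorem caseH_ball {V : Set (EuclideanSpace ℝ (Fin 3))} (hV : IsUnitBallPacking V)
    {u q : EuclideanSpace ℝ (Fin 3)} {R : ℝ} (hR : 4 ≤ R) (hq : q ∈ V)
    (hpat : ∀ v ∈ V, dist u v < 2 * R - 2 →
      IsArrangedIn (kissingShell V v) fccKissingPattern ∨ IsArrangedIn (kissingShell V v) hcpKissingPattern)
    (L : EuclideanSpace ℝ (Fin 3) ≃ₗᵢ[ℝ] EuclideanSpace ℝ (Fin 3)) {s₀ : ℝ} (hs₀ : s₀ = 1 ∨ s₀ = -1)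
    (hshell0 : kissingShell {x | q + L x ∈ V} 0 = layerShell s₀ s₀)
    (hnonneg : 0 ≤ (L.symm (u - q)) 2) (hD : (L.symm (u - q)) 2 ≤ R - 3 / 2)
    (hdq : dist u q < 2 * R - 2) :
    ∃ s : ℤ → ℤ, IsHaggSeq s ∧
      ∃ g : EuclideanSpace ℝ (Fin 3) ≃ᵢ EuclideanSpace ℝ (Fin 3),
        ∀ v ∈ V, dist u v ≤ R → v ∈ g '' barlowStacking 2 (2 * Real.sqrt (2 / 3)) s := by
  -- the frame
  set V' : Set (EuclideanSpace ℝ (Fin 3)) := {x | q + L x ∈ V} with hV'def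
  set u' : EuclideanSpace ℝ (Fin 3) := L.symm (u - q) with hu'def
  have hV' : IsUnitBallPacking V' := hV.preimage q L
  have h0V : (0 : EuclideanSpace ℝ (Fin 3)) ∈ V' := by simp [hV'def, hq]
  have hpat' : ∀ x ∈ V', dist x u' < 2 * R - 2 →
      IsArrangedIn (kissingShell V' x) fccKissingPattern ∨
        IsArrangedIn (kissingShell V' x) hcpKissingPattern := by
    intro x hx hd
    rw [hu'def, dist_frame_eq L x] at hd
    rw [hV'def, kissingShell_preimage]
    rcases hpat _ hx hd with h | h
    · exact Or.inl (h.preimage L)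
    · exact Or.inr (h.preimage L)
  have hdu' : dist (0 : EuclideanSpace ℝ (Fin 3)) u' = dist u q := dist_zero_symm_sub_eq L
  have hnorm_u' : ‖u'‖ = dist u q := by rw [← hdu', dist_comm, dist_zero_right]
  have hnu' : ‖u'‖ < 2 * R - 2 := by rw [hnorm_u']; exact hdq
  -- the height `a` (in units of `𝗁`) and the foot `c` of the axis
  set a : ℝ := u' 2 / layerSpacing with ha
  set c : EuclideanSpace ℝ (Fin 3) := u' - a • layerNormal layerSpacing with hcdef
  have hh := layerSpacing_pos
  have hc2 : c 2 = 0 := by simp [hcdef, ha, hh.ne']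
  have hu'c : u' = c + a • layerNormal layerSpacing := by rw [hcdef]; abel
  have ha0 : 0 ≤ a := div_nonneg hnonneg hh.le
  have hau : a * layerSpacing = u' 2 := by rw [ha]; field_simp
  have haD : a * layerSpacing ≤ R - 3 / 2 := by rw [hau]; exact hD
  have hcu : ‖c‖ ^ 2 + 8 / 3 * a ^ 2 = ‖u'‖ ^ 2 := by
    conv_rhs => rw [hu'c]
    rw [norm_sq_add_smul_frameE hc2]
  -- patterns in the cylinder: a point `y` with horizontal foot within `P` and height `t𝗁`
  have good_of : ∀ (y : EuclideanSpace ℝ (Fin 3)) (t P : ℝ), y 2 = t * layerSpacing →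
      ‖y - (c + t • layerNormal layerSpacing)‖ ≤ P → 0 ≤ P →
      P ^ 2 + 8 / 3 * (t - a) ^ 2 < (2 * R - 2) ^ 2 → dist y u' < 2 * R - 2 := by
    intro y t P hy hP hP0 hlt
    have hor : (y - (c + t • layerNormal layerSpacing)) 2 = 0 := by simp [hy, hc2]
    have e : y - u' = (y - (c + t • layerNormal layerSpacing)) + (t - a) • layerNormal layerSpacing := by
      rw [hu'c]; module
    have h1 : dist y u' ^ 2 < (2 * R - 2) ^ 2 := by
      rw [dist_eq_norm, e, norm_sq_add_smul_frameE hor]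
      nlinarith [norm_nonneg (y - (c + t • layerNormal layerSpacing))]
    exact (abs_lt_of_sq_lt_sq' h1 (by linarith)).2
  have hu'2 : ‖u'‖ ^ 2 < (2 * R - 2) ^ 2 := pow_lt_pow_left₀ hnu' (norm_nonneg _) two_ne_zero
  -- descent along the base plane to a lattice centre within `√2` of the foot
  obtain ⟨i₀, j₀, h₀c, h₀V, h₀⟩ := hcp_descent hV' hs₀ hc2 (fun i j hij hmem => hpat' _ hmem (by
      refine good_of _ 0 ‖c‖ (by rw [zero_mul]; exact lattice_apply_two i j) (by simpa using hij)
        (norm_nonneg _) ?_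
      have e : (0 - a) ^ 2 = a ^ 2 := by ring
      rw [e, hcu]; exact hu'2)) h0V hshell0
  -- the schedules
  obtain ⟨Nu, Pu, Ru, hPu0, hbase_in, hPu2, hRu, hparu, hfaru, hgoodu, hcovu⟩ := up_schedule hR ha0 haD
  obtain ⟨Nd, Pd, Rd, hPd0, hPd2, hRd, hpard, hfard, hgoodd, hcovd⟩ := down_schedule hR ha0 haD
  have hPu_nn : ∀ n ≤ Nu, 0 ≤ Pu n := fun n hn => (Real.sqrt_nonneg 2).trans (hPu2 n hn)
  have hPd_nn : ∀ n ≤ Nd, 0 ≤ Pd n := fun n hn => (Real.sqrt_nonneg 2).trans (hPd2 n hn)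
  -- the base disc of radius `Pu 0`
  have hbase : ∀ i j : ℤ,
      ‖((i : ℝ) • (triangularVec₁ 2 : EuclideanSpace ℝ (Fin 3)) + (j : ℝ) • triangularVec₂ 2) - c‖ ≤ Pu 0 →
      (i : ℝ) • (triangularVec₁ 2 : EuclideanSpace ℝ (Fin 3)) + (j : ℝ) • triangularVec₂ 2 ∈ V' ∧
      kissingShell V' ((i : ℝ) • (triangularVec₁ 2 : EuclideanSpace ℝ (Fin 3)) + (j : ℝ) • triangularVec₂ 2)
        = layerShell s₀ s₀ := by
    refine hcp_disc hV' hs₀ hc2 (R := Pu 0) (fun i j hij hmem => hpat' _ hmem ?_) h₀c h₀V h₀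
    refine good_of _ 0 (Pu 0) (by simp) (by simpa using hij) (hPu_nn 0 (Nat.zero_le _)) ?_
    simpa using hbase_in
  have hbase_d : ∀ i j : ℤ,
      ‖((i : ℝ) • (triangularVec₁ 2 : EuclideanSpace ℝ (Fin 3)) + (j : ℝ) • triangularVec₂ 2) - c‖ ≤ Pd 0 → _ :=
    fun i j h => hbase i j (h.trans (by rw [hPu0]; exact hPd0))
  -- the layers above
  obtain ⟨sp, sp0, hsp, hAup⟩ := layers_up hV' hc2 (fun y => dist y u' < 2 * R - 2) (fun _ => False)
    (fun y hy hg => hpat' y hy hg) (fun y _ hz => hz.elim) Nu Pu Ru hPu2 hRu hparu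
    (fun n hn y _ hy2 hyd => good_of y ((n : ℝ) + 1) (Pu (n + 1)) hy2 hyd (hPu_nn (n + 1) (by omega))
      (hgoodu n hn (Pu (n + 1)) (hPu_nn (n + 1) (by omega)) le_rfl))
    (fun n hn => Or.inr (hfaru n hn))
    hs₀ h₀c hbase
  -- the layers below
  obtain ⟨sm, sm0, hsm, hAdn⟩ := layers_down hV' hc2 (fun y => dist y u' < 2 * R - 2) (fun _ => False)
    (fun y hy hg => hpat' y hy hg) (fun y _ hz => hz.elim) Nd Pd Rd hPd2 hRd hpard
    (fun n hn y _ hy2 hyd => by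
      refine good_of y (-((n : ℝ) + 1)) (Pd (n + 1)) (by rw [hy2]; ring) ?_ (hPd_nn (n + 1) (by omega)) ?_
      · rw [neg_smul, ← sub_eq_add_neg]; exact hyd
      · have := hgoodd n hn (Pd (n + 1)) (hPd_nn (n + 1) (by omega)) le_rfl
        have e : (-((n : ℝ) + 1) - a) ^ 2 = ((n : ℝ) + 1 + a) ^ 2 := by ring
        rw [e]; exact this)
    (fun n hn => Or.inr (hfard n hn))
    hs₀ h₀c hbase_d
  -- the Hägg sequence and the certified stacking points
  obtain ⟨sZ, hsZ, hLp, hLm, hsZp, hsZm⟩ := exists_haggSeq_of_signs sp sm hsp hsm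
  obtain ⟨certUp, certDn⟩ := layers_shell (V := V') Nu Nd Pu Pd hsZ sp sm hLp hLm hsZp hsZm sp0 sm0
    hbase hAup hAdn
  clear hAup hAdn hbase hbase_d hgoodu hgoodd hparu hpard hfaru hfard hRu hRd
  have hcert : ∀ k i j : ℤ, dist (barlowPos 2 layerSpacing sZ k i j) u' ≤ R - 4 / 5 →
      barlowPos 2 layerSpacing sZ k i j ∈ V' ∧
        kissingShell V' (barlowPos 2 layerSpacing sZ k i j) =
          kissingShell (barlowStacking 2 layerSpacing sZ) (barlowPos 2 layerSpacing sZ k i j) := by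
    intro k i j hd
    obtain ⟨yh, hyh⟩ : ∃ yh : EuclideanSpace ℝ (Fin 3), yh = (i : ℝ) • (triangularVec₁ 2 : EuclideanSpace ℝ (Fin 3)) +
        (j : ℝ) • triangularVec₂ 2 + ((haggLabel sZ k : ℤ) : ℝ) • barlowOffset 2 := ⟨_, rfl⟩
    have hy : barlowPos 2 layerSpacing sZ k i j = yh + (k : ℝ) • layerNormal layerSpacing := by
      rw [hyh]; rfl
    have hor : (yh - c) 2 = 0 := by rw [hyh]; simp [hc2]
    have hdist : ‖yh - c‖ ^ 2 + 8 / 3 * ((k : ℝ) - a) ^ 2 ≤ (R - 4 / 5) ^ 2 := by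
      have e : barlowPos 2 layerSpacing sZ k i j - u' = (yh - c) + ((k : ℝ) - a) • layerNormal layerSpacing := by
        rw [hy, hu'c]; module
      have h1 : dist (barlowPos 2 layerSpacing sZ k i j) u' ^ 2 ≤ (R - 4 / 5) ^ 2 :=
        pow_le_pow_left₀ dist_nonneg hd 2
      rw [dist_eq_norm, e, norm_sq_add_smul_frameE hor] at h1
      exact h1
    rcases le_or_gt 0 k with hk | hk
    · -- layers `k ≥ 0`
      have ek : ((k.toNat : ℕ) : ℤ) = k := Int.toNat_of_nonneg hk
      have ekr : ((k.toNat : ℕ) : ℝ) = (k : ℝ) := by exact_mod_cast ek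
      obtain ⟨hnNu, hcov⟩ := hcovu k.toNat (‖yh - c‖ ^ 2) (sq_nonneg _) (by rw [ekr]; exact hdist)
      have hle : ‖yh - c‖ ≤ Pu k.toNat :=
        (pow_le_pow_iff_left₀ (norm_nonneg _) (hPu_nn _ hnNu) two_ne_zero).1 hcov
      have := certUp k.toNat hnNu i j (by rw [ek, ← hyh]; exact hle)
      rwa [ek] at this
    · -- layers `k < 0`
      have ek : (((-k).toNat : ℕ) : ℤ) = -k := Int.toNat_of_nonneg (by omega)
      have ekr : (((-k).toNat : ℕ) : ℝ) = -(k : ℝ) := by exact_mod_cast ek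
      have h1n : 1 ≤ (-k).toNat := by omega
      obtain ⟨hnNd, hcov⟩ := hcovd (-k).toNat (‖yh - c‖ ^ 2) h1n (sq_nonneg _)
        (by rw [ekr]; have e : (-(k : ℝ) + a) ^ 2 = ((k : ℝ) - a) ^ 2 := by ring
            rw [e]; exact hdist)
      have hle : ‖yh - c‖ ≤ Pd (-k).toNat :=
        (pow_le_pow_iff_left₀ (norm_nonneg _) (hPd_nn _ hnNd) two_ne_zero).1 hcov
      have ek' : -(((-k).toNat : ℕ) : ℤ) = k := by rw [ek, neg_neg]
      have := certDn (-k).toNat h1n hnNd i j (by rw [ek', ← hyh]; exact hle)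
      rwa [ek'] at this
  -- the walk
  have hwalk := walk hV' (s := sZ) (u' := u') hR (ν := R - 4 / 5) (by linarith) (by linarith)
    (fun x hx hxR => hpat' x hx (by linarith)) hcert
  -- back to the original coordinates
  refine ⟨sZ, hsZ, L.toIsometryEquiv.trans (IsometryEquiv.addLeft q), fun v hv hvu => ?_⟩
  set x : EuclideanSpace ℝ (Fin 3) := L.symm (v - q) with hx
  have hxv : q + L x = v := by rw [hx, LinearIsometryEquiv.apply_symm_apply]; abel
  have hxV : x ∈ V' := by simp [hV'def, hxv, hv]
  have hxu : dist x u' ≤ R := by rw [hu'def, dist_frame_eq L x, hxv]; exact hvu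
  refine ⟨x, hwalk x hxV hxu, ?_⟩
  simp [hxv.symm]

end Summit.AtomisticToContinuum.Crystallization.Theorems
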